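import Summits.QuantumFields.BalabanUV.Beta.D1BFx.TorusGaugeWeight
import Summits.QuantumFields.BalabanUV.Beta.D1BFx.TorusHodgeWeight
import Summits.QuantumFields.BalabanUV.Beta.D1BFx.TorusBorderedResolventPack

/-!
# `BalabanUV.Beta.D1BFx.TorusZerothJunction` — road «BF-x» for binder row D1, slot (K), `K-ASSEMBLY-SPEC-v2.md` §4 (TB5, first socket):
# **THE ZEROTH-ORDER JUNCTION OF ROUTE T** — on every coarse torus the N-side KKT matrix `N_T = kkt (2•X̂(0)) Q̂` IS K-TA4G (R2)'s
# `N₀ = kkt (K₀ + T₀ᵀA₀T₀) Q₀` with `K₀ := K̂` (TB1's sorted `d*d` block), `Q₀ := Q̂`, and the CANONICAL CO-FRAME WEIGHT DATUM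
# `T₀ := NᵀL̂D̂ₛᵀ`, `A₀ := 2•(NᵀL̂L̂N)⁻¹`, `W₀ := D̂ₛN` of ANY basis `N` of the block-mean-free gauge functions; `det A₀ ≠ 0`, `det (T₀W₀) ≠ 0`,
# `det N₀ ≠ 0`, and **`N₀⁻¹ = blocksHat p (sortK (m+1) (NlegRoad m a))`** (the ℤ⁴ R-weighted leg pack) — modulo `Spr (Ga (m+1) a)` and the basis facts

HONEST FRAMING (cell contract, verbatim): «discharging `BetaPertH` makes Bałaban's UV stability UNCONDITIONAL — a real constructive-QFT
result; it is NOT the continuum limit and NOT the Clay problem.»  HONEST DEPENDENCY (verbatim): «continuum YM on T⁴ ⇐ BetaPertH ∧ nine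
spine estimates (0/9 proved); BetaPertH ⇐ (D1) ∧ (D4) ∧ CAP+tail; G-an2-4 gates asym, D1 and NE2/3/4.»  THIS MODULE DISCHARGES NOTHING of
D1 / BetaPertH: [folklore] three-line compositions BY NAME of this lineage's `TorusGaugeWeight` (K-TB3b-J: `two_smul_weight_eq_gram`,
`coframe_mul_basis`, `det_weightA_ne_zero`, `det_coframe_mul_basis_ne_zero`), gan24-leaf-06-g31's `TorusHodgeWeight` (K-TB3b-H:
`two_smul_Xhat_zero`, `RGhat_eq_DhatS`, `DhatS_transpose_mul_DhatS`), this lineage's `TorusBorderedResolvent` (`NT_eq`) ∕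
`TorusBorderedResolventPack` (3c-3: `inv_NT_eq_blocksHat`) and leaf-03-g8's `TorusAveragingGram` (`isUnit_det_NT_road`).  No `def`, no
`def … : Prop`, nothing cited, 0 sorry.  DISPLAYED: the basis facts `hN` ∕ `hNinj` (K-TB3b FILE 1, `TorusGaugeBasis.Nhat`) and the decay
`hGa : Spr (Ga (m+1) a)` (= printed [B5, Prop. 1.2] ∧ [(1.126)–(1.127)] via `GluonLegTails.spr_Ga_of_prop12`).  NOT summit progress;
NOT BetaPertH, NOT continuum, NOT Clay.

ABSOLUTE RULE (cell, verbatim): «No internally-minted statement may enter as a cited fact. Every hypothesis is either kernel-proved in this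
package or a verbatim quotation of a PUBLISHED theorem with page reference. The manuscript(s) under audit are NOT citable for their own
disputed steps — they are the thing under adjudication; programme-internal (2001/route/tribunal) claims are never citable.»

CONTENT (`m`, `a > 0`, coarse period `p`, fine period `(m+1)·p`; sorted currency `ν = I 3 (m+1) p`, `μ = J 3 p`; `N : Matrix (Site 4 ((m+1)p)) ρ ℝ`
with `hN`, `hNinj`; the datum written out: `T₀ = Nᵀ * Lhat _ * (DhatS m p)ᵀ`, `A₀ = 2 • (Nᵀ * Lhat _ * Lhat _ * N)⁻¹`, `W₀ = DhatS m p * N`; all [folklore]).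
* §1 **`two_smul_Xhat_zero_eq_gram`** (`2•X̂(0) = K̂ + T₀ᵀA₀T₀`), **`NT_eq_kkt_gram`** (`N_T = kkt (K̂ + T₀ᵀA₀T₀) Q̂`).
* §2 `coframe_mul_basis_road` (`T₀W₀ = NᵀL̂L̂N`), `det_coframe_mul_basis_road_ne_zero` (K-TA4G's `hT`), `det_weightA_road_ne_zero` (`hA`).
* §3 `isUnit_det_kkt_gram`, `det_kkt_gram_ne_zero` and **`inv_kkt_gram_eq_blocksHat`**: `(kkt (K̂ + T₀ᵀA₀T₀) Q̂)⁻¹ = blocksHat p (sortK (m+1) (NlegRoad m a))`.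
Unit `b2b-balaban-beta-d1-p2` (road owner, gen 6).
-/

noncomputable section

namespace Summit.QuantumFields.BalabanUV.Beta.D1BFx.TorusZerothJunction

open Matrix
open scoped BigOperators
open Literature.MathematicalPhysics.QuantumFieldTheory.Balaban1983to89
open Literature.MathematicalPhysics.QuantumFieldTheory.Balaban1983to89.Beta
open Literature.MathematicalPhysics.QuantumFieldTheory.Balaban1983to89.Beta.Composition (kkt)
open Summit.QuantumFields.BalabanUV.Beta.TameKernelCalculus (Spr)
open Summit.QuantumFields.BalabanUV.Beta.D1BFx.SortedKernels (blocksHat)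
open Summit.QuantumFields.BalabanUV.Beta.D1BFx.SortedPack (sortK)
open Summit.QuantumFields.BalabanUV.Beta.D1BFx.TorusCombKKT (I J Khat Qhat)
open Summit.QuantumFields.BalabanUV.Beta.D1BFx.PeriodisedProjector (Phat Lhat Shat)
open Summit.QuantumFields.BalabanUV.Beta.D1BFx.TorusBorderedResolvent (Xhat NT NT_eq)
open Summit.QuantumFields.BalabanUV.Beta.D1BFx.TorusBorderedResolventPack (inv_NT_eq_blocksHat)
open Summit.QuantumFields.BalabanUV.Beta.D1BFx.TorusAveragingGram (isUnit_det_NT_road)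
open Summit.QuantumFields.BalabanUV.Beta.D1BFx.TorusHodgeWeight (DhatS RGhat two_smul_Xhat_zero RGhat_eq_DhatS DhatS_transpose_mul_DhatS)
open Summit.QuantumFields.BalabanUV.Beta.D1BFx.TorusGaugeWeight (two_smul_weight_eq_gram coframe_mul_basis det_weightA_ne_zero
  det_coframe_mul_basis_ne_zero)
open Summit.QuantumFields.BalabanUV.Beta.D1BFx.RWeightedLegPack (NlegRoad)

variable (m : ℕ) {a : ℝ} (p : ℕ) [NeZero p] {ρ : Type*} [Fintype ρ] [DecidableEq ρ]

/-! ## §1 `2•X̂(0) = K̂ + T₀ᵀA₀T₀` and `N_T = kkt (K̂ + T₀ᵀA₀T₀) Q̂` -/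

/-- [folklore] **THE ZEROTH-ORDER WEIGHT JUNCTION**: for any basis `N` of the block-mean-free gauge functions on the fine torus,
`2•X̂(0) = K̂ + T₀ᵀA₀T₀` with `T₀ := NᵀL̂D̂ₛᵀ`, `A₀ := 2•(NᵀL̂L̂N)⁻¹` (K-TB3b-H `two_smul_Xhat_zero` ∘ `RGhat_eq_DhatS` ∘ K-TB3b-J `two_smul_weight_eq_gram`). -/
theorem two_smul_Xhat_zero_eq_gram (ha : 0 < a) {N : Matrix (Site 4 ((m + 1) * p)) ρ ℝ}
    (hN : ∀ lam : Site 4 ((m + 1) * p) → ℝ, Shat m ((m + 1) * p) *ᵥ lam = 0 ↔ ∃ c : ρ → ℝ, lam = N *ᵥ c)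
    (hNinj : Function.Injective N.mulVec) :
    (2 : ℝ) • Xhat m a p 0 = Khat (d := 3) (m + 1) p
      + (Nᵀ * Lhat ((m + 1) * p) * (DhatS m p)ᵀ)ᵀ * ((2 : ℝ) • (Nᵀ * Lhat ((m + 1) * p) * Lhat ((m + 1) * p) * N)⁻¹)
          * (Nᵀ * Lhat ((m + 1) * p) * (DhatS m p)ᵀ) := by
  rw [two_smul_Xhat_zero m p ha, RGhat_eq_DhatS m p ha, two_smul_weight_eq_gram ha rfl hN hNinj (DhatS m p)]

/-- [folklore] **`N_T = N₀`**: the N-side KKT matrix of `TorusBorderedResolvent` IS K-TA4G (R2)'s `kkt (K₀ + T₀ᵀA₀T₀) Q₀` with `K₀ = K̂`, `Q₀ = Q̂`. -/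
theorem NT_eq_kkt_gram (ha : 0 < a) {N : Matrix (Site 4 ((m + 1) * p)) ρ ℝ}
    (hN : ∀ lam : Site 4 ((m + 1) * p) → ℝ, Shat m ((m + 1) * p) *ᵥ lam = 0 ↔ ∃ c : ρ → ℝ, lam = N *ᵥ c)
    (hNinj : Function.Injective N.mulVec) :
    NT m a p = kkt (Khat (d := 3) (m + 1) p
      + (Nᵀ * Lhat ((m + 1) * p) * (DhatS m p)ᵀ)ᵀ * ((2 : ℝ) • (Nᵀ * Lhat ((m + 1) * p) * Lhat ((m + 1) * p) * N)⁻¹)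
          * (Nᵀ * Lhat ((m + 1) * p) * (DhatS m p)ᵀ)) (Qhat (d := 3) (m + 1) p) := by
  rw [NT_eq, two_smul_Xhat_zero_eq_gram m p ha hN hNinj]

/-! ## §2 The weight datum is non-degenerate: `T₀W₀ = NᵀL̂L̂N`, `det (T₀W₀) ≠ 0`, `det A₀ ≠ 0` -/

omit [Fintype ρ] [DecidableEq ρ] in
/-- [folklore] **`T₀·W₀ = NᵀL̂L̂N`** on the road (`D̂ₛᵀD̂ₛ = L̂`, `TorusHodgeWeight.DhatS_transpose_mul_DhatS`). -/
theorem coframe_mul_basis_road (N : Matrix (Site 4 ((m + 1) * p)) ρ ℝ) :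
    Nᵀ * Lhat ((m + 1) * p) * (DhatS m p)ᵀ * (DhatS m p * N) = Nᵀ * Lhat ((m + 1) * p) * Lhat ((m + 1) * p) * N :=
  coframe_mul_basis (DhatS_transpose_mul_DhatS m p)

/-- [folklore] **K-TA4G's `hT`**: `det (T₀·W₀) ≠ 0`. -/
theorem det_coframe_mul_basis_road_ne_zero (ha : 0 < a) {N : Matrix (Site 4 ((m + 1) * p)) ρ ℝ}
    (hN : ∀ lam : Site 4 ((m + 1) * p) → ℝ, Shat m ((m + 1) * p) *ᵥ lam = 0 ↔ ∃ c : ρ → ℝ, lam = N *ᵥ c)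
    (hNinj : Function.Injective N.mulVec) :
    (Nᵀ * Lhat ((m + 1) * p) * (DhatS m p)ᵀ * (DhatS m p * N)).det ≠ 0 :=
  det_coframe_mul_basis_ne_zero ha rfl hN hNinj (DhatS_transpose_mul_DhatS m p)

/-- [folklore] **K-TA4G's `hA`**: `det A₀ ≠ 0`. -/
theorem det_weightA_road_ne_zero (ha : 0 < a) {N : Matrix (Site 4 ((m + 1) * p)) ρ ℝ}
    (hN : ∀ lam : Site 4 ((m + 1) * p) → ℝ, Shat m ((m + 1) * p) *ᵥ lam = 0 ↔ ∃ c : ρ → ℝ, lam = N *ᵥ c)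
    (hNinj : Function.Injective N.mulVec) :
    ((2 : ℝ) • (Nᵀ * Lhat ((m + 1) * p) * Lhat ((m + 1) * p) * N)⁻¹).det ≠ 0 :=
  det_weightA_ne_zero ha rfl hN hNinj

/-! ## §3 `N₀` is invertible and `N₀⁻¹` IS the periodised R-weighted leg pack -/

/-- [folklore] **`det N₀ ≠ 0`** (`IsUnit` form), modulo `Spr (Ga (m+1) a)` (`TorusAveragingGram.isUnit_det_NT_road`). -/
theorem isUnit_det_kkt_gram (ha : 0 < a) (hGa : Spr (GluonLeg.Ga (m + 1) a)) {N : Matrix (Site 4 ((m + 1) * p)) ρ ℝ}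
    (hN : ∀ lam : Site 4 ((m + 1) * p) → ℝ, Shat m ((m + 1) * p) *ᵥ lam = 0 ↔ ∃ c : ρ → ℝ, lam = N *ᵥ c)
    (hNinj : Function.Injective N.mulVec) :
    IsUnit (kkt (Khat (d := 3) (m + 1) p
      + (Nᵀ * Lhat ((m + 1) * p) * (DhatS m p)ᵀ)ᵀ * ((2 : ℝ) • (Nᵀ * Lhat ((m + 1) * p) * Lhat ((m + 1) * p) * N)⁻¹)
          * (Nᵀ * Lhat ((m + 1) * p) * (DhatS m p)ᵀ)) (Qhat (d := 3) (m + 1) p)).det := by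
  rw [← NT_eq_kkt_gram m p ha hN hNinj]
  exact isUnit_det_NT_road m ha hGa p

/-- [folklore] **K-TA4G's non-degeneracy for `N₀`**: `det N₀ ≠ 0`. -/
theorem det_kkt_gram_ne_zero (ha : 0 < a) (hGa : Spr (GluonLeg.Ga (m + 1) a)) {N : Matrix (Site 4 ((m + 1) * p)) ρ ℝ}
    (hN : ∀ lam : Site 4 ((m + 1) * p) → ℝ, Shat m ((m + 1) * p) *ᵥ lam = 0 ↔ ∃ c : ρ → ℝ, lam = N *ᵥ c)
    (hNinj : Function.Injective N.mulVec) :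
    (kkt (Khat (d := 3) (m + 1) p
      + (Nᵀ * Lhat ((m + 1) * p) * (DhatS m p)ᵀ)ᵀ * ((2 : ℝ) • (Nᵀ * Lhat ((m + 1) * p) * Lhat ((m + 1) * p) * N)⁻¹)
          * (Nᵀ * Lhat ((m + 1) * p) * (DhatS m p)ᵀ)) (Qhat (d := 3) (m + 1) p)).det ≠ 0 :=
  (isUnit_det_kkt_gram m p ha hGa hN hNinj).ne_zero

/-- [folklore] **`N₀⁻¹ = blocksHat p (sortK (m+1) (NlegRoad m a))`** — the inverse of K-TA4G (R2)'s zeroth-order N-matrix on every coarse torus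
IS the sorted periodisation of the ℤ⁴ R-weighted leg pack (3c-3 `inv_NT_eq_blocksHat`), modulo `Spr (Ga (m+1) a)` and the basis facts. -/
theorem inv_kkt_gram_eq_blocksHat (ha : 0 < a) (hGa : Spr (GluonLeg.Ga (m + 1) a)) {N : Matrix (Site 4 ((m + 1) * p)) ρ ℝ}
    (hN : ∀ lam : Site 4 ((m + 1) * p) → ℝ, Shat m ((m + 1) * p) *ᵥ lam = 0 ↔ ∃ c : ρ → ℝ, lam = N *ᵥ c)
    (hNinj : Function.Injective N.mulVec) :
    (kkt (Khat (d := 3) (m + 1) p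
      + (Nᵀ * Lhat ((m + 1) * p) * (DhatS m p)ᵀ)ᵀ * ((2 : ℝ) • (Nᵀ * Lhat ((m + 1) * p) * Lhat ((m + 1) * p) * N)⁻¹)
          * (Nᵀ * Lhat ((m + 1) * p) * (DhatS m p)ᵀ)) (Qhat (d := 3) (m + 1) p))⁻¹
      = blocksHat p (sortK (m + 1) (NlegRoad m a)) := by
  rw [← NT_eq_kkt_gram m p ha hN hNinj]
  exact inv_NT_eq_blocksHat m ha hGa p

end Summit.QuantumFields.BalabanUV.Beta.D1BFx.TorusZerothJunction

end
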